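import Literature.MathematicalPhysics.QuantumFieldTheory.Balaban1983to89.B8Eq142KLevelLocalRec
import Literature.MathematicalPhysics.QuantumFieldTheory.Balaban1983to89.B8Eq131CubesRec
import Literature.MathematicalPhysics.QuantumFieldTheory.Balaban1983to89.B8Eq119TwistedAxialRec

/-!
# `Balaban1983to89.B8Prop6CubeMemberEq137Rec` — RECORD TWIN of `B8Prop6CubeMemberEq137` §1∕§2 ([Balaban1985RegularSpaces] PROPOSITION 6 (p. 99), THE IDENTITY OF (1.137)
# «Q_k(ηA) = (1∕i) log Ū₀′ᵏ on □^{(k)}»: the generic tower-local identity `Q_{j+1}(1, B)(c) = log Ū′^{j+1}(c)` at the background `1`, and the CENTRED geometry of the bonds of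
# `□^{(k)}` inside the member) FOR THE SYMMETRISED CENTRED block averaging (0.4) of [Balaban1987RG1], with the RECORD's Prop-4 regime

statement-level skeleton of published theorems with citation tags; proofs where landed; nothing here is a claim about the Yang–Mills mass gap

T. Bałaban, *Spaces of regular gauge field configurations on a lattice and gauge fixing conditions*, Commun. Math. Phys. **99** (1985) 75–102 `[Balaban1985RegularSpaces]`
("[6]"): Prop. 6 (1.137) p. 99, (1.37) p. 82, (1.31) p. 82, p. 98 (the cubes `□ ⊂ □_k`); T. Bałaban, *Averaging operations for lattice gauge theories*, Commun. Math. Phys. **98**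
(1985) 17–51 `[Balaban1985Averaging]` ("[3]"): p. 24 (locality after (43)), (87) p. 31, (127) p. 37, Prop. 4 p. 38; T. Bałaban, *Renormalization group approach to lattice gauge
field theories. I*, Commun. Math. Phys. **109** (1987) 249–301 `[Balaban1987RG1]` ("[I]"): (0.3)–(0.4) pp. 252–253.  STATUS: published.

CITATION HEADER (lean-in-tree rule).  Cell `pub-ymgap`, «N05-REC» stage 2 (director-ym №254∕№255∕№288), item R6 (the crown road), module (c) of the lead pen's `R6-PLAN.md` —
typed by the LEAD PEN dag-n05-e g38 on dag-n05-c's recipe (inventory `N05-REC-INVENTORY.md` §R6 row `B8Prop6CubeMemberEq137`: class A = `logCovIter_one_eq_mlog_avgIter_loc_of_window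
logCovIter_one_eq_mlog_avgIter_loc`).  WHAT IS REPRODUCED = ✓`B8Prop6CubeMemberEq137` §1 (the generic identity at the background `1`, over the record's global form
`B8Eq137QjEqBRec.Qj_eq_Bint_regular`, transported by `B7LocalityRec.{logCovIterZ_congr, avgIterZ_congr}`, `B8Ineq172ConcreteRec.wrecZ_congr_tower` and the centred bond-box
geometry `B8Eq142KLevelLocalRec.inBox_box_of_tower_fst ∕ _snd`) and §2 (both ends of a bond of `□^{(k)}` are level-`k` labels of `□_k^{(k)}`; its CENTRED fine box
`Bᵏ(c₋) ∪ Bᵏ(c₊) = [Lᵏx − c_k𝟙, Lᵏx + Lᵏe_μ + c_k𝟙]` lies in the centred `□ = boxZ` and is the union of the two centred `k`-blocks `UnderZ`).  TOKEN MAP: `logCovIter ∕ avgIter ∕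
wrec ∕ tildIter ↦ logCovIterZ ∕ avgIterZ ∕ wrecZ ∕ tildIterZ`; corner boxes `[loK, bondHiK]`, `box`, `Under` ↦ centred boxes, `boxZ`, `UnderZ`; the engine's flat window
`16·C₁·L^{j+1}b ≤ 1`, `2L^{j+1}b ≤ c₃` ↦ the record's `4·C₁·KZ²·L^{j+1}b ≤ 1`, `KZ·L^{j+1}b ≤ c₃` (`C₁ = 131072(d+1)²`, `KZ = 2(1 + 2gZ)`), the free (1.40)-parameter of the flat
background now with `e^{4cZ·α} ≤ 4∕3`.  Declaration names = engine names (T5) up to the `Z` suffix on the geometry.  The engine's §3 (the identity at the PURE member) is not on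
the crown's kernel cone and is not twinned.  Kind «kernel-checked proof», theorems only; no `def`, no `instance`, no `notation`, no existing module modified.
`--supports stmt-QuantumFields-20541` (K0⁷-keyed, COUNT-NEUTRAL).

HONEST SCOPE: tower-local form of the record (1.37) identity by restriction and locality, plus integer box bookkeeping; nothing of Bałaban's analysis re-proved; `HThm4Rec`
UNDISCHARGED; caveat (C-S3-1) + addendum v4 stand; N05 [B8] DISCHARGED OF RECORD untouched; COUNT of record unmoved · K numerically unchanged; one finite `𝕋⁴` programme at
fixed `ε`, Bałaban AS PRINTED; nothing continuum ∕ ℝ⁴ ∕ OS ∕ mass-gap ∕ Clay.  No `sorry`, no `def`.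

[cite: Balaban1985RegularSpaces, Prop. 6 (1.137) p.99, (1.37) p.82, p.98; Balaban1985Averaging, p.24, (87) p.31, (127) p.37, Prop. 4 p.38; Balaban1987RG1, (0.3)–(0.4) pp.252–253]
-/

noncomputable section

open NormedSpace

namespace Literature.MathematicalPhysics.QuantumFieldTheory.Balaban1983to89.B8Prop6CubeMemberEq137Rec

open Complex (I)
open MatrixLog B7Prop1Explicit B7Prop2Explicit B7Prop1Local B7AvgGaugeCovariance
open B7Eq92Concrete (mgauge mgauge_one_left)
open B7Prop3Flat (expCfg c3 insCfg)
open B7Prop5Flat (bondsIn restr mem_bondsIn insCfg_restr_of_mem agreeOn_insCfg_restr BondIn)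
open B7Prop2Rec (AvgClosedZ C0Z C0Z_pos)
open B7Prop4GeneralLevelsRec (cZ gZ KZ)
open BlockAveragingZd (avgIterZ ctrShift two_mul_ctrShift_add_one)
open B7SectCDGaugeAveragesRec (wrecZ tildIterZ tildIterZ_apply)
open B7SectEFLinearisationRec (logCovIterZ)
open B7LocalityRec (logCovIterZ_congr avgIterZ_congr)
open B8Ineq130Rec (tlo thi)
open B8Ineq130 (hol_one)
open B8Eq115GaugeFixing (gaugeAct_agree)
open B8Thm2LogB (Bint)
open B8Ineq172ConcreteRec (wrecZ_congr_tower)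
open B8Eq137QjEqBRec (Qj_eq_Bint_regular)
open B8Eq142KLevelLocalRec (inBox_box_of_tower_fst inBox_box_of_tower_snd)
open B8Eq131CubesRec (bLoZ bHiZ sqLoZ sqHiZ boxZ cubeZ box_subset_cube_top)
open B8Eq119TwistedAxialRec (UnderZ)

-- `Site` alone could resolve to the torus sites of `Setup.lean`; re-export the `ℤ^d` sites of `B7Prop1Explicit`.
export B7Prop1Explicit (Site)

variable {d : ℕ}

/-! ## §1 The generic tower-local identity `Q_{j+1}(1, B)(c) = log Ū′^{j+1}(c)` at the background `1`, RECORD averaging -/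

section Generic

/-- (RECORD TWIN of `B8Prop6CubeMemberEq137.exists_flat_window`.) **At the background `1` the (1.40)-parameter of the record's Prop-4 regime is free**: there is `α > 0` with
`C0Z·α ≤ 1∕3`, `4α ≤ c₂′` and `exp(4cZ·α) ≤ 4∕3` (so that the record window `e^{4cZ·α}(1 + 2C₁KZ²·Lᵏb) ≤ 2` follows from `4C₁KZ²·Lᵏb ≤ 1`).
[cite: Balaban1985Averaging, Prop. 4 p.38 (the regime), p.37 (after (127)); Balaban1987RG1, (0.4) p.253] -/
theorem exists_flat_windowZ (d : ℕ) {L : ℕ} (hL : 1 ≤ L) :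
    ∃ α : ℝ, 0 < α ∧ C0Z d * α ≤ 1 / 3 ∧ 4 * α ≤ c2' d L ∧ Real.exp (4 * cZ d * α) ≤ 4 / 3 := by
  have hC0 := C0Z_pos d
  have hc2 := c2'_pos d L hL
  set c : ℝ := 4 * cZ d with hc
  have hcpos : 0 < c := by rw [hc]; unfold cZ; positivity
  have hlog : 0 < Real.log (4 / 3) := Real.log_pos (by norm_num)
  refine ⟨min (Real.log (4 / 3) / c) (min (1 / (3 * C0Z d)) (c2' d L / 4)), ?_, ?_, ?_, ?_⟩
  · exact lt_min (div_pos hlog hcpos) (lt_min (by positivity) (by positivity))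
  · calc C0Z d * min (Real.log (4 / 3) / c) (min (1 / (3 * C0Z d)) (c2' d L / 4))
          ≤ C0Z d * (1 / (3 * C0Z d)) :=
            mul_le_mul_of_nonneg_left ((min_le_right _ _).trans (min_le_left _ _)) hC0.le
      _ = 1 / 3 := by field_simp
  · calc 4 * min (Real.log (4 / 3) / c) (min (1 / (3 * C0Z d)) (c2' d L / 4))
          ≤ 4 * (c2' d L / 4) := mul_le_mul_of_nonneg_left ((min_le_right _ _).trans (min_le_right _ _)) (by norm_num)
      _ = c2' d L := by ring
  · have hce : 4 * cZ d * min (Real.log (4 / 3) / c) (min (1 / (3 * C0Z d)) (c2' d L / 4)) =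
        c * min (Real.log (4 / 3) / c) (min (1 / (3 * C0Z d)) (c2' d L / 4)) := by rw [hc]
    rw [hce]
    calc Real.exp (c * min (Real.log (4 / 3) / c) (min (1 / (3 * C0Z d)) (c2' d L / 4)))
          ≤ Real.exp (c * (Real.log (4 / 3) / c)) :=
            Real.exp_le_exp.2 (mul_le_mul_of_nonneg_left (min_le_left _ _) hcpos.le)
      _ = 4 / 3 := by rw [mul_div_cancel₀ _ hcpos.ne', Real.exp_log (by norm_num)]

variable {𝔸 : Type*} [NormedRing 𝔸] [NormOneClass 𝔸] [NormedAlgebra ℂ 𝔸] [CompleteSpace 𝔸]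

omit [NormOneClass 𝔸] [NormedAlgebra ℂ 𝔸] [CompleteSpace 𝔸] in
/-- The restriction `B|_{box}` (zero outside the bonds of the box) is bounded by a common bound of `B` on the box's bonds (private plumbing, as in `B8Eq142KLevelLocalRec`).
[folklore] -/
private theorem norm_insCfg_restr_le' {lo hi : Site d} {B : Site d → Fin d → 𝔸} {b : ℝ}
    (hB : ∀ x μ, BondIn lo hi x μ → ‖B x μ‖ ≤ b) (hb : 0 ≤ b) :
    ∀ x μ, ‖insCfg (bondsIn lo hi) (restr (bondsIn lo hi) B) x μ‖ ≤ b := fun x μ => by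
  by_cases h : (x, μ) ∈ bondsIn lo hi
  · rw [insCfg_restr_of_mem _ _ h]; exact hB x μ (mem_bondsIn.mp h)
  · simp only [insCfg, h, dite_false, norm_zero]; exact hb

variable {G : Type*} in
/-- Agreement on a box restricts to agreement on any sub-box (private plumbing). [folklore] -/
private theorem agreeOn_of_subbox {lo hi LO HI : Site d} {V V' : Site d → Fin d → G}
    (hsub : ∀ x, InBox lo hi x → InBox LO HI x) (h : AgreeOn LO HI V V') : AgreeOn lo hi V V' :=
  fun x κ hx hxe => h x κ (hsub x hx) (hsub _ hxe)

omit [NormOneClass 𝔸] [NormedAlgebra ℂ 𝔸] [CompleteSpace 𝔸] in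
/-- `pdev 1 = 0`: every plaquette variable of the configuration `1` is `1`. [folklore] -/
private theorem pdev_one' : pdev (1 : Site d → Fin d → 𝔸ˣ) = 0 := by
  unfold pdev; simp [hol_one]

omit [NormOneClass 𝔸] in
/-- At `U₀ = 1` the record's `Ũ′ʲ` (69) is the plain record average `Ū₁ʲ` (`\overline{1}ʲ = 1`, `BlockAveragingZd.avgIterZ_one`; private plumbing).
[cite: Balaban1985Averaging, (69) p.29; Balaban1987RG1, (0.4) p.253] -/
private theorem tildIterZ_one_left' (L : ℕ) (U₁ : Site d → Fin d → 𝔸ˣ) (j : ℕ) (z : Site d) (κ : Fin d) :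
    tildIterZ L (1 : Site d → Fin d → 𝔸ˣ) U₁ j z κ = avgIterZ L U₁ j z κ := by
  rw [tildIterZ_apply, mul_one, BlockAveragingZd.avgIterZ_one, Pi.one_apply, Pi.one_apply, inv_one, mul_one]

/-- (RECORD TWIN of `B8Prop6CubeMemberEq137.logCovIter_one_eq_mlog_avgIter_loc`.) **THE IDENTITY «Q_j(U₀, ηA) = B on Λ_j» ((1.37) first half; (1.31) first line
`B_b = (1∕i) log Ũ′ʲ_b`) AT THE BACKGROUND `U₀ = 1`, ONE INTERIOR BOND, FROM BOX DATA, RECORD AVERAGING** (tower-local form of `B8Eq137QjEqBRec.Qj_eq_Bint_regular` at the flat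
background, `Ũ′ʲ = Ū′ʲ`): at a bond `c = ⟨y, y + e_κ⟩` of the `(j+1)`-lattice, if on the CENTRED fine box `B^{j+1}(c₋) ∪ B^{j+1}(c₊) = [L^{j+1}y − c_{j+1}𝟙, L^{j+1}y + L^{j+1}e_κ +
c_{j+1}𝟙]` the field is `U₁ = e^{B}` (`hU₁`) with `‖B_b‖ ≤ b`, `L^{j+1}b` in the record's Prop-4 window at a free parameter `α` (`hα3`, `hα4`, `hsm`, `hc₃`; cf.
`exists_flat_windowZ`; odd `L = 2s+1`, `s ≥ 1`, `d ≥ 1`), and `u` satisfies (87) of [3] at `c₋`, `c₊` for the pair `(1, U₁)` (record frames `wrecZ`), THEN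
`Q_{j+1}(1, B)(c) = log Ū′^{j+1}(c)`, `U′ = U₁^{u} = gaugeAct u U₁`, record averages.  PROOF: restrict `B` to the box, global lemma (`pdev 1 = 0`), transport back.
[cite: Balaban1985RegularSpaces, (1.37) p.82, (1.31) p.82, Prop. 6 (1.137) p.99; Balaban1985Averaging, (127) p.37, (87) p.31, p.24 (locality); Balaban1987RG1, (0.3)–(0.4) pp.252–253] -/
theorem logCovIter_one_eq_mlog_avgIter_loc {L s : ℕ} (hLs : L = 2 * s + 1) (hs : 1 ≤ s) (hd : 1 ≤ d) {G : Subgroup 𝔸ˣ} (hG : AvgClosedZ d L G)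
    (j : ℕ) (y : Site d) (κ : Fin d)
    {α : ℝ} (hα : 0 < α) (hα3 : C0Z d * α ≤ 1 / 3) (hα4 : 4 * α ≤ c2' d L)
    (B : Site d → Fin d → 𝔸) {b : ℝ} (hb : 0 ≤ b)
    (hB : ∀ x μ, BondIn (fun i => (L : ℤ) ^ (j + 1) * y i - (ctrShift L (j + 1) : ℤ))
      (fun i => (L : ℤ) ^ (j + 1) * y i + (ctrShift L (j + 1) : ℤ) + if i = κ then (L : ℤ) ^ (j + 1) else 0) x μ → ‖B x μ‖ ≤ b)
    (hsm : Real.exp (4 * cZ d * α) * (1 + 2 * (131072 * ((d : ℝ) + 1) ^ 2) * (KZ d L) ^ 2 * ((L : ℝ) ^ (j + 1) * b)) ≤ 2)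
    (hc₃ : KZ d L * ((L : ℝ) ^ (j + 1) * b) ≤ c3 d L)
    (u : Site d → 𝔸ˣ) (U₁ : Site d → Fin d → 𝔸ˣ)
    (hU₁ : AgreeOn (fun i => (L : ℤ) ^ (j + 1) * y i - (ctrShift L (j + 1) : ℤ))
      (fun i => (L : ℤ) ^ (j + 1) * y i + (ctrShift L (j + 1) : ℤ) + if i = κ then (L : ℤ) ^ (j + 1) else 0) U₁ (expCfg B))
    (hm : uLev L u (j + 1) y = (wrecZ L (1 : Site d → Fin d → 𝔸ˣ) U₁ (j + 1) y)⁻¹)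
    (hp : uLev L u (j + 1) (y + e κ) = (wrecZ L (1 : Site d → Fin d → 𝔸ˣ) U₁ (j + 1) (y + e κ))⁻¹) :
    logCovIterZ L (1 : Site d → Fin d → 𝔸ˣ) B (j + 1) y κ = mlog ((avgIterZ L (gaugeAct u U₁) (j + 1) y κ : 𝔸ˣ) : 𝔸) := by
  have hL : Odd L := ⟨s, by omega⟩
  have hLr : (0 : ℝ) < (L : ℝ) := by exact_mod_cast (show 0 < L by omega)
  set lo : Site d := fun i => (L : ℤ) ^ (j + 1) * y i - (ctrShift L (j + 1) : ℤ) with hlo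
  set hi : Site d := fun i => (L : ℤ) ^ (j + 1) * y i + (ctrShift L (j + 1) : ℤ) + if i = κ then (L : ℤ) ^ (j + 1) else 0 with hhi
  -- the restricted exponent field, its global bound, the agreements on the box
  set B' := insCfg (bondsIn lo hi) (restr (bondsIn lo hi) B) with hB'_def
  have hB' : ∀ x μ, ‖B' x μ‖ ≤ b := norm_insCfg_restr_le' hB hb
  have hag1 : AgreeOn lo hi (1 : Site d → Fin d → 𝔸ˣ) (1 : Site d → Fin d → 𝔸ˣ) := fun _ _ _ _ => rfl
  have hagB : AgreeOn lo hi B B' := agreeOn_insCfg_restr lo hi B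
  have hagE : AgreeOn lo hi U₁ (expCfg B') := fun x μ hx hxe => by
    rw [hU₁ x μ hx hxe]
    apply Units.ext
    show exp (B x μ) = exp (B' x μ)
    rw [hagB x μ hx hxe]
  -- (87) at `c₋`, `c₊` for the restricted pair: the record block frames (85) are tower-local
  have hw : ∀ z : Site d, (∀ x, InBox (tlo L z (j + 1)) (thi L z (j + 1)) x → InBox lo hi x) →
      wrecZ L (1 : Site d → Fin d → 𝔸ˣ) U₁ (j + 1) z = wrecZ L (1 : Site d → Fin d → 𝔸ˣ) (expCfg B') (j + 1) z := by
    intro z hsub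
    exact wrecZ_congr_tower hLs (agreeOn_of_subbox hsub hag1) (agreeOn_of_subbox hsub hagE) (j + 1) 0 (by omega) z
      (by rw [B8Ineq130Rec.tlo_zero]) (by rw [B8Ineq130Rec.thi_zero])
  rw [hw y fun x hx => inBox_box_of_tower_fst hL (j + 1) y κ hx] at hm
  rw [hw (y + e κ) fun x hx => inBox_box_of_tower_snd hL (j + 1) y κ hx] at hp
  have hone : ∀ x μ, (1 : Site d → Fin d → 𝔸ˣ) x μ ∈ G := fun _ _ => G.one_mem
  have h40 : pdev (1 : Site d → Fin d → 𝔸ˣ) < α * (((L : ℝ) ^ (j + 1))⁻¹) ^ 2 := by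
    rw [pdev_one']
    exact mul_pos hα (pow_pos (inv_pos.mpr (pow_pos hLr (j + 1))) 2)
  have key := Qj_eq_Bint_regular hLs hs hd hG (j + 1) (1 : Site d → Fin d → 𝔸ˣ) hone hα hα3 hα4 h40 B' hb hB' hsm hc₃ u
    (Nat.le_succ j) y κ hm hp
  rw [tildIterZ_one_left', mgauge_one_left, Bint, smul_smul, mul_inv_cancel₀ Complex.I_ne_zero, one_smul] at key
  have hav : avgIterZ L (gaugeAct u (expCfg B')) (j + 1) y κ = avgIterZ L (gaugeAct u U₁) (j + 1) y κ :=
    avgIterZ_congr hLs (j + 1) y κ (gaugeAct_agree hagE.symm u)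
  rw [hav] at key
  rwa [logCovIterZ_congr hLs (j + 1) y κ hag1 hagB.symm] at key

/-- (RECORD TWIN of `B8Prop6CubeMemberEq137.logCovIter_one_eq_mlog_avgIter_loc_of_window`.) **The same with the `α`-free record window** `4·C₁·KZ²·(L^{j+1}b) ≤ 1`,
`KZ·L^{j+1}b ≤ c₃(d, L)` (the flat background's (1.40)-parameter chosen by `exists_flat_windowZ`).
[cite: Balaban1985RegularSpaces, (1.37) p.82, Prop. 6 (1.137) p.99; Balaban1985Averaging, (127) p.37, Prop. 4 p.38; Balaban1987RG1, (0.4) p.253] -/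
theorem logCovIter_one_eq_mlog_avgIter_loc_of_window {L s : ℕ} (hLs : L = 2 * s + 1) (hs : 1 ≤ s) (hd : 1 ≤ d) {G : Subgroup 𝔸ˣ} (hG : AvgClosedZ d L G)
    (j : ℕ) (y : Site d) (κ : Fin d) (B : Site d → Fin d → 𝔸) {b : ℝ} (hb : 0 ≤ b)
    (hB : ∀ x μ, BondIn (fun i => (L : ℤ) ^ (j + 1) * y i - (ctrShift L (j + 1) : ℤ))
      (fun i => (L : ℤ) ^ (j + 1) * y i + (ctrShift L (j + 1) : ℤ) + if i = κ then (L : ℤ) ^ (j + 1) else 0) x μ → ‖B x μ‖ ≤ b)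
    (h4 : 4 * (131072 * ((d : ℝ) + 1) ^ 2) * (KZ d L) ^ 2 * ((L : ℝ) ^ (j + 1) * b) ≤ 1)
    (hc₃ : KZ d L * ((L : ℝ) ^ (j + 1) * b) ≤ c3 d L)
    (u : Site d → 𝔸ˣ) (U₁ : Site d → Fin d → 𝔸ˣ)
    (hU₁ : AgreeOn (fun i => (L : ℤ) ^ (j + 1) * y i - (ctrShift L (j + 1) : ℤ))
      (fun i => (L : ℤ) ^ (j + 1) * y i + (ctrShift L (j + 1) : ℤ) + if i = κ then (L : ℤ) ^ (j + 1) else 0) U₁ (expCfg B))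
    (hm : uLev L u (j + 1) y = (wrecZ L (1 : Site d → Fin d → 𝔸ˣ) U₁ (j + 1) y)⁻¹)
    (hp : uLev L u (j + 1) (y + e κ) = (wrecZ L (1 : Site d → Fin d → 𝔸ˣ) U₁ (j + 1) (y + e κ))⁻¹) :
    logCovIterZ L (1 : Site d → Fin d → 𝔸ˣ) B (j + 1) y κ = mlog ((avgIterZ L (gaugeAct u U₁) (j + 1) y κ : 𝔸ˣ) : 𝔸) := by
  have hL1 : 1 ≤ L := by omega
  obtain ⟨α, hα, hα3, hα4, hexp⟩ := exists_flat_windowZ d hL1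
  have hK : 0 ≤ (131072 * ((d : ℝ) + 1) ^ 2) * (KZ d L) ^ 2 * ((L : ℝ) ^ (j + 1) * b) := by positivity
  have hsm : Real.exp (4 * cZ d * α) * (1 + 2 * (131072 * ((d : ℝ) + 1) ^ 2) * (KZ d L) ^ 2 * ((L : ℝ) ^ (j + 1) * b)) ≤ 2 := by
    have h1 : 1 + 2 * (131072 * ((d : ℝ) + 1) ^ 2) * (KZ d L) ^ 2 * ((L : ℝ) ^ (j + 1) * b) ≤ 3 / 2 := by nlinarith
    have h0 : 0 ≤ 1 + 2 * (131072 * ((d : ℝ) + 1) ^ 2) * (KZ d L) ^ 2 * ((L : ℝ) ^ (j + 1) * b) := by nlinarith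
    calc Real.exp (4 * cZ d * α) * (1 + 2 * (131072 * ((d : ℝ) + 1) ^ 2) * (KZ d L) ^ 2 * ((L : ℝ) ^ (j + 1) * b))
          ≤ (4 / 3) * (3 / 2) := mul_le_mul hexp h1 h0 (by norm_num)
      _ = 2 := by norm_num
  exact logCovIter_one_eq_mlog_avgIter_loc hLs hs hd hG j y κ hα hα3 hα4 B hb hB hsm hc₃ u U₁ hU₁ hm hp

end Generic

/-! ## §2 Geometry of `□^{(k)}` inside the member `{□_j}`, CENTRED -/

section Geometry

/-- (RECORD TWIN of `B8Prop6CubeMemberEq137.mem_cubeLamS_top_of_sq`.) **Both ends of a bond `⟨x, x + e_μ⟩ ⊂ □^{(k)} = [a, a + M − 1]ᵈ` are level-`k` labels of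
`Λ_k = □_k^{(k)} = [a − ρ, a + M − 1 + ρ]ᵈ`** (print's `Λ′_k = □_k^{(k)} ⊇ □^{(k)}`, margin `R₁M₁ = ρ ≥ 0`; level-`k` labels carry no centring shift, `c₀ = 0`).
[cite: Balaban1985RegularSpaces, (1.131) p.99 («Λ′_k = □_k^{(k)}»), p.98] -/
theorem inBox_sq_top_of_bond (L : ℕ) (a : Site d) (M ρ k : ℕ) {x : Site d} {μ : Fin d}
    (hx : bLoZ L a 0 0 ≤ x) (hx' : x + e μ ≤ bHiZ L a M 0 0) :
    InBox (sqLoZ L a ρ k k) (sqHiZ L a M ρ k k) x ∧ InBox (sqLoZ L a ρ k k) (sqHiZ L a M ρ k k) (x + e μ) := by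
  have hxx : x ≤ x + e μ := le_add_of_nonneg_right (B8Lemma1NonAbelian.e_nonneg μ)
  have h1 : InBox (bLoZ L a 0 0) (bHiZ L a M 0 0) x := fun i => ⟨hx i, (hxx i).trans (hx' i)⟩
  have h2 : InBox (bLoZ L a 0 0) (bHiZ L a M 0 0) (x + e μ) := fun i => ⟨(hx i).trans (hxx i), hx' i⟩
  simp only [sqLoZ, sqHiZ, Nat.sub_self]
  exact ⟨B8Eq131CubesRec.inBox_margin_mono (Nat.zero_le _) h1, B8Eq131CubesRec.inBox_margin_mono (Nat.zero_le _) h2⟩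

/-- (RECORD TWIN of `B8Prop6CubeMemberEq137.mem_box_of_bondBox`.) **The CENTRED fine box `Bᵏ(c₋) ∪ Bᵏ(c₊) = [Lᵏx − c_k𝟙, Lᵏx + Lᵏe_μ + c_k𝟙]` of a bond `c ⊂ □^{(k)}` lies in
the centred `□ = [Lᵏa − c_k, Lᵏ(a + M) − 1 − c_k]ᵈ`** (`2c_k + 1 = Lᵏ`, odd `L`: `□` is the union of the centred `Lᵏ`-blocks over `□^{(k)}`).
[cite: Balaban1985RegularSpaces, p.98 («we take a size of □ equal to MLʲη»); Balaban1985Averaging, p.24 (the box `Bᵏ(c₋) ∪ Bᵏ(c₊)`); Balaban1987RG1, (0.3) p.252] -/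
theorem mem_boxZ_of_bondBox {L : ℕ} (hL : Odd L) (a : Site d) (M k : ℕ) {x : Site d} {μ : Fin d}
    (hx : bLoZ L a 0 0 ≤ x) (hx' : x + e μ ≤ bHiZ L a M 0 0) {z : Site d}
    (hz : InBox (fun i => (L : ℤ) ^ k * x i - (ctrShift L k : ℤ)) (fun i => (L : ℤ) ^ k * x i + (ctrShift L k : ℤ) + if i = μ then (L : ℤ) ^ k else 0) z) :
    z ∈ boxZ L a M k := by
  have hc : 2 * (ctrShift L k : ℤ) + 1 = (L : ℤ) ^ k := by exact_mod_cast two_mul_ctrShift_add_one hL k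
  have h0 : ctrShift L 0 = 0 := by simp [ctrShift]
  intro i
  obtain ⟨h1, h2⟩ := hz i
  have hP : (0 : ℤ) ≤ (L : ℤ) ^ k := by positivity
  have hxi := hx i
  have hxi' := hx' i
  rw [add_e_apply] at hxi'
  simp only [bLoZ, bHiZ, pow_zero, one_mul, h0, Nat.cast_zero, sub_zero, add_zero] at hxi hxi' ⊢
  dsimp only at h1 h2
  constructor
  · nlinarith
  · split_ifs at h2 hxi' <;> nlinarith

/-- Hence the centred fine box of a bond of `□^{(k)}` lies in the top cube `□_k ⊇ □` of the member (odd `L`). [cite: Balaban1985RegularSpaces, p.98 («□_k, □»); Balaban1987RG1, (0.3) p.252] -/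
theorem mem_cubeZ_top_of_bondBox {L : ℕ} (hL : Odd L) (a : Site d) (M ρ k : ℕ) {x : Site d} {μ : Fin d}
    (hx : bLoZ L a 0 0 ≤ x) (hx' : x + e μ ≤ bHiZ L a M 0 0) {z : Site d}
    (hz : InBox (fun i => (L : ℤ) ^ k * x i - (ctrShift L k : ℤ)) (fun i => (L : ℤ) ^ k * x i + (ctrShift L k : ℤ) + if i = μ then (L : ℤ) ^ k else 0) z) :
    z ∈ cubeZ L a M ρ k k :=
  box_subset_cube_top hL a M ρ k (mem_boxZ_of_bondBox hL a M k hx hx' hz)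

/-- (RECORD TWIN of `B8Prop6DentedCubeMemberGauged.under_or_under_of_inBox_bondBox`.) **THE CENTRED FINE BOX OF A LEVEL-`j` BOND IS THE UNION OF ITS TWO CENTRED
`j`-BLOCKS**: `x ∈ [Lʲz − c_j𝟙, Lʲz + Lʲe_μ + c_j𝟙] ⇒ x ∈ Bʲ(z) ∨ x ∈ Bʲ(z + e_μ)` (`UnderZ`; `c_j + 1 = Lʲ − c_j`, odd `L`).
[cite: Balaban1985Averaging, p.24 (sentence after (43)); Balaban1985RegularSpaces, (1.6) p.77; Balaban1987RG1, (0.3) p.252] -/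
theorem under_or_under_of_inBox_bondBoxZ {L : ℕ} (hL : Odd L) {j : ℕ} {z : Site d} {μ : Fin d} {x : Site d}
    (hx : InBox (fun i => (L : ℤ) ^ j * z i - (ctrShift L j : ℤ)) (fun i => (L : ℤ) ^ j * z i + (ctrShift L j : ℤ) + if i = μ then (L : ℤ) ^ j else 0) x) :
    UnderZ L j z x ∨ UnderZ L j (z + e μ) x := by
  have hc : 2 * (ctrShift L j : ℤ) + 1 = (L : ℤ) ^ j := by exact_mod_cast two_mul_ctrShift_add_one hL j
  by_cases hκ : x μ ≤ (L : ℤ) ^ j * z μ + (ctrShift L j : ℤ)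
  · refine Or.inl fun i => ?_
    obtain ⟨h1, h2⟩ := hx i
    dsimp only at h1 h2
    by_cases hi : i = μ
    · subst hi; constructor <;> linarith
    · rw [if_neg hi] at h2; constructor <;> linarith
  · refine Or.inr fun i => ?_
    obtain ⟨h1, h2⟩ := hx i
    dsimp only at h1 h2
    simp only [Pi.add_apply, e, Pi.single_apply]
    by_cases hi : i = μ
    · subst hi; simp only [if_true] at h2 ⊢; constructor <;> linarith
    · rw [if_neg hi] at h2; rw [if_neg hi]; constructor <;> linarith

end Geometry

end Literature.MathematicalPhysics.QuantumFieldTheory.Balaban1983to89.B8Prop6CubeMemberEq137Rec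

end
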